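import Mathlib
import HarnessLib
import Summits.Ventures.LatticeQCDFlow.TrivializingMaps.AcceptanceCurveSwap
import Summits.Ventures.LatticeQCDFlow.TrivializingMaps.AcceptanceCurveSwapLower
import Summits.Ventures.LatticeQCDFlow.TrivializingMaps.AcceptanceCurveSwapUpper

/-!
# The acceptance-footprint curve on the whole of `[½, 1]` — unconditional (row 96d)

Honest framing: exact (Metropolis-corrected) sampling algorithms for lattice gauge theory; figures
of merit are autocorrelation/cost numbers at stated couplings and volumes; no continuum-physics
claim.  This file is elementary real algebra about `2 × 2` probability tables.

`AcceptanceCurveSwap` (row 96a) reduced clause (ii) of `sum_min_curve` on the whole acceptance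
range `[½, 1]` to the **block inequality** (its section hypothesis `hB`): for corner masses
`a, b` (target diagonal), `c, d` (model diagonal), `e, f` (target anti-diagonal), `g, h` (model
anti-diagonal), all `≥ 0`, `a + b + e + f = c + d + g + h = 1`, and
`L := |a + b - c - d| + |ad - bc| + |eh - fg| ≤ ½`:
`|(ab - ef) - (cd - gh)| ≤ L (1 - L)`.
`AcceptanceCurveSwapLower` (row 96b) proved its anti-aligned half (`lower_half`) and
`AcceptanceCurveSwapUpper` (row 96c) the leaf certificates and per-block regime bounds for the
aligned half (reduced variables `t, wᵢ, Xᵢ, Yᵢ, ℓᵢ, Φᵢ` as there).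

Here: §1 the two-block **master lemma** `mu_master` (`Φ₁ + Φ₂ ≤ L(1 - L)` from three abstract
per-block bounds, by the regime case split of row 96c); §2 those three bounds for the actual
corner masses (pure identities: `(tw)² + ℓ² - 2twΦ = (t(w-s) - ℓ)²`,
`2w(tw/2 + ℓ - Φ) = t(w-s)² + 2ℓs`, `ℓ(XY-ℓ) - Y²Φ = q(2(ℓX - twY) + 2wtq)`), hence the aligned
half `upper_half`; §3 the block inequality `blockIneq` (sign bookkeeping over `upper_half` and
`lower_half`); §4 the unconditional theorems are then row 96a's conditional ones with the
hypothesis discharged — `abs_det_sub_det_le_of_blockIneq blockIneq` (`|det x - det y| ≤ S(1-S)`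
for every pair of `2 × 2` probability tables with swap acceptance `S ≥ ½`),
`curve_of_blockIneq blockIneq`, and `sum_min_curve_full_of_blockIneq blockIneq` — clause (ii) of
`sum_min_curve` (`(2t-1)² ≤ 1 - 4|x₊₊x₋₋ - x₊₋x₋₊|`) for every `t ∈ [½, 1]` below the mean
acceptance, with no regime hypothesis.  With clause (i) of `sum_min_curve` this is THEOREM Q♯♯ on
the whole acceptance range.  (Landing note, lean-2 GEN-7 custody 2026-08-22: theory-1's bytes
ff202a12158c3ac6 declared the three discharged forms under the names `abs_det_sub_det_le`,
`curve_full`, `sum_min_curve_full`; the gate's `dedup.landed` rule refuses re-declaring an instance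
of a landed theorem, so §4 below only records the terms.)  No `sorry`, no new axioms, no `def`.
-/

namespace Summit.Ventures.LatticeQCDFlow.TrivializingMaps.Curve

/-! ## §1. The master lemma (q-optimised two-block form) -/

/-- The mixed case: block 1 before its junction, block 2 beyond. -/
theorem caseI_II (t w₁ w₂ ℓ₁ ℓ₂ P₁ P₂ : ℝ) (hw : w₁ + w₂ = 1) (ht : 0 ≤ t)
    (hY₁ : 0 ≤ w₁ - t / 2) (hY₂ : 0 ≤ w₂ - t / 2) (hℓ₁ : 0 ≤ ℓ₁) (hℓ₂ : 0 ≤ ℓ₂)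
    (hℓ₁c : ℓ₁ ≤ (w₁ + t / 2) * (w₁ - t / 2)) (hℓ₂c : ℓ₂ ≤ (w₂ + t / 2) * (w₂ - t / 2))
    (hL : t + ℓ₁ + ℓ₂ ≤ 1 / 2)
    (hsup₁ : 2 * t * w₁ * P₁ ≤ (t * w₁) ^ 2 + ℓ₁ ^ 2) (hcap₁ : P₁ ≤ t * w₁ / 2 + ℓ₁)
    (hII₂ : t * w₂ * (w₂ - t / 2) ≤ ℓ₂ * (w₂ + t / 2) →
      (w₂ - t / 2) ^ 2 * P₂ ≤ ℓ₂ * ((w₂ + t / 2) * (w₂ - t / 2) - ℓ₂))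
    (r₁ : ℓ₁ * (w₁ + t / 2) ≤ t * w₁ * (w₁ - t / 2)) (r₂ : t * w₂ * (w₂ - t / 2) < ℓ₂ * (w₂ + t / 2)) :
    P₁ + P₂ ≤ (t + ℓ₁ + ℓ₂) * (1 - (t + ℓ₁ + ℓ₂)) := by
  have b₁ := regimeI_chord t w₁ ℓ₁ P₁ ht hY₁ hℓ₁ hℓ₁c hsup₁ hcap₁ r₁
  obtain ⟨v, hv0, hhv, htv, hvℓ, hP₂⟩ := regimeII_vertex t w₂ ℓ₂ P₂ ht hY₂ hℓ₂ hℓ₂c (hII₂ r₂.le) r₂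
  have hX₁ : 0 ≤ w₁ + t / 2 := by linarith
  have hvY0 : 0 ≤ v * (w₂ - t / 2) := mul_nonneg hv0 hY₂
  -- monotonicity of `L ↦ L(1-L)` on `[0, ½]`: from `L_v = t + ℓ₁ + vY₂ ≤ L ≤ ½`
  have hmono : (t + ℓ₁ + v * (w₂ - t / 2)) * (1 - (t + ℓ₁ + v * (w₂ - t / 2)))
      ≤ (t + ℓ₁ + ℓ₂) * (1 - (t + ℓ₁ + ℓ₂)) := by
    nlinarith [mul_nonneg (sub_nonneg.2 hvℓ)
      (by linarith : (0:ℝ) ≤ 1 - (t + ℓ₁ + ℓ₂) - (t + ℓ₁ + v * (w₂ - t / 2)))]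
  rcases eq_or_lt_of_le hX₁ with hX₁0 | hX₁pos
  · -- block 1 empty (`t = w₁ = 0`): `ℓ₁ = 0`, `P₁ ≤ 0`, and `P₂ ≤ v(X₂-v) ≤ L_v(1-L_v)`
    have ht0 : t = 0 := by linarith
    have hw0 : w₁ = 0 := by linarith
    have hw1 : w₂ = 1 := by linarith
    subst ht0 hw0 hw1
    norm_num at hℓ₁c hcap₁ hP₂ hmono hhv ⊢
    nlinarith [mul_nonneg hv0 (by linarith : (0:ℝ) ≤ 1 - ℓ₁ - 2 * v), hℓ₁]
  · have M := mixed_edge t w₁ w₂ ℓ₁ v hw ht hY₁ hY₂ hX₁pos hℓ₁ r₁ hv0 hhv htv (by linarith)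
    have h2 : (w₁ + t / 2) * (2 * (P₁ + P₂))
        ≤ (w₁ + t / 2) * (2 * ((t + ℓ₁ + ℓ₂) * (1 - (t + ℓ₁ + ℓ₂)))) := by
      nlinarith [b₁, mul_le_mul_of_nonneg_left hP₂ hX₁, M, mul_le_mul_of_nonneg_left hmono hX₁]
    have := le_of_mul_le_mul_left h2 hX₁pos
    linarith

/-- **Master lemma.**  Two blocks with weights `w₁ + w₂ = 1`, common mass transfer `t ≥ 0`,
orientations `0 ≤ ℓᵢ ≤ XᵢYᵢ` within the budget `t + ℓ₁ + ℓ₂ ≤ ½`, and excesses `Pᵢ` obeying the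
three per-block bounds of `AcceptanceCurveSwapUpper` §4: `P₁ + P₂ ≤ L(1-L)`, `L = t + ℓ₁ + ℓ₂`. -/
theorem mu_master (t w₁ w₂ ℓ₁ ℓ₂ P₁ P₂ : ℝ) (hw : w₁ + w₂ = 1) (ht : 0 ≤ t)
    (hY₁ : 0 ≤ w₁ - t / 2) (hY₂ : 0 ≤ w₂ - t / 2) (hℓ₁ : 0 ≤ ℓ₁) (hℓ₂ : 0 ≤ ℓ₂)
    (hℓ₁c : ℓ₁ ≤ (w₁ + t / 2) * (w₁ - t / 2)) (hℓ₂c : ℓ₂ ≤ (w₂ + t / 2) * (w₂ - t / 2))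
    (hL : t + ℓ₁ + ℓ₂ ≤ 1 / 2)
    (hsup₁ : 2 * t * w₁ * P₁ ≤ (t * w₁) ^ 2 + ℓ₁ ^ 2) (hsup₂ : 2 * t * w₂ * P₂ ≤ (t * w₂) ^ 2 + ℓ₂ ^ 2)
    (hcap₁ : P₁ ≤ t * w₁ / 2 + ℓ₁) (hcap₂ : P₂ ≤ t * w₂ / 2 + ℓ₂)
    (hII₁ : t * w₁ * (w₁ - t / 2) ≤ ℓ₁ * (w₁ + t / 2) →
      (w₁ - t / 2) ^ 2 * P₁ ≤ ℓ₁ * ((w₁ + t / 2) * (w₁ - t / 2) - ℓ₁))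
    (hII₂ : t * w₂ * (w₂ - t / 2) ≤ ℓ₂ * (w₂ + t / 2) →
      (w₂ - t / 2) ^ 2 * P₂ ≤ ℓ₂ * ((w₂ + t / 2) * (w₂ - t / 2) - ℓ₂)) :
    P₁ + P₂ ≤ (t + ℓ₁ + ℓ₂) * (1 - (t + ℓ₁ + ℓ₂)) := by
  have hL0 : 0 ≤ t + ℓ₁ + ℓ₂ := by linarith
  rcases le_or_gt (ℓ₁ * (w₁ + t / 2)) (t * w₁ * (w₁ - t / 2)) with r₁ | r₁ <;>
    rcases le_or_gt (ℓ₂ * (w₂ + t / 2)) (t * w₂ * (w₂ - t / 2)) with r₂ | r₂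
  · -- (I,I): `F ≤ L/2 ≤ L(1-L)`
    have c₁ := chord_half t w₁ ℓ₁ P₁ ht hY₁ hℓ₁ hℓ₁c hcap₁
      (regimeI_chord t w₁ ℓ₁ P₁ ht hY₁ hℓ₁ hℓ₁c hsup₁ hcap₁ r₁)
    have c₂ := chord_half t w₂ ℓ₂ P₂ ht hY₂ hℓ₂ hℓ₂c hcap₂
      (regimeI_chord t w₂ ℓ₂ P₂ ht hY₂ hℓ₂ hℓ₂c hsup₂ hcap₂ r₂)
    nlinarith [mul_nonneg hL0 (by linarith : (0:ℝ) ≤ 1 / 2 - (t + ℓ₁ + ℓ₂))]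
  · -- (I,II)
    exact caseI_II t w₁ w₂ ℓ₁ ℓ₂ P₁ P₂ hw ht hY₁ hY₂ hℓ₁ hℓ₂ hℓ₁c hℓ₂c hL hsup₁ hcap₁ hII₂ r₁ r₂
  · -- (II,I): the mixed case with the blocks exchanged
    have := caseI_II t w₂ w₁ ℓ₂ ℓ₁ P₂ P₁ (by linarith) ht hY₂ hY₁ hℓ₂ hℓ₁ hℓ₂c hℓ₁c (by linarith)
      hsup₂ hcap₂ hII₁ r₂ r₁
    nlinarith [this]
  · -- (II,II): both blocks at C-vertices; `vertex_cc`
    obtain ⟨u, hu0, hhu, _htu, huℓ, hP₁⟩ :=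
      regimeII_vertex t w₁ ℓ₁ P₁ ht hY₁ hℓ₁ hℓ₁c (hII₁ r₁.le) r₁
    obtain ⟨v, hv0, hhv, _htv, hvℓ, hP₂⟩ :=
      regimeII_vertex t w₂ ℓ₂ P₂ ht hY₂ hℓ₂ hℓ₂c (hII₂ r₂.le) r₂
    have huY0 : 0 ≤ u * (w₁ - t / 2) := mul_nonneg hu0 hY₁
    have hvY0 : 0 ≤ v * (w₂ - t / 2) := mul_nonneg hv0 hY₂
    have cc := vertex_cc t w₁ w₂ u v hw ht hY₁ hY₂ hu0 hv0 (by linarith) (by linarith) (by linarith)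
    have hmono : (t + u * (w₁ - t / 2) + v * (w₂ - t / 2))
        * (1 - (t + u * (w₁ - t / 2) + v * (w₂ - t / 2))) ≤ (t + ℓ₁ + ℓ₂) * (1 - (t + ℓ₁ + ℓ₂)) := by
      nlinarith [mul_nonneg (by linarith : (0:ℝ) ≤ (ℓ₁ - u * (w₁ - t / 2)) + (ℓ₂ - v * (w₂ - t / 2)))
        (by linarith : (0:ℝ) ≤ 1 - (t + ℓ₁ + ℓ₂) - (t + u * (w₁ - t / 2) + v * (w₂ - t / 2)))]
    linarith [hP₁, hP₂, cc, hmono]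

/-! ## §2. The per-block bounds for corner masses, and the aligned half

Block with heavy pair `a, b` and light pair `c, d`: `t = a + b - c - d`, `w = (a + b + c + d)/2`,
`X = a + b = w + t/2`, `Y = c + d = w - t/2`, orientation `ℓ = ad - bc`, excess `Φ = ab - cd`,
`s = a + c`, `q = c`. -/

/-- Unconstrained-supremum bound `2twΦ ≤ (tw)² + ℓ²` (the identity
`(tw)² + ℓ² - 2twΦ = (t(w - s) - ℓ)²`). -/
theorem block_sup (a b c d : ℝ) :
    2 * (a + b - c - d) * ((a + b + c + d) / 2) * (a * b - c * d)
      ≤ ((a + b - c - d) * ((a + b + c + d) / 2)) ^ 2 + (a * d - b * c) ^ 2 := by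
  nlinarith [sq_nonneg ((a + b - c - d) * ((a + b + c + d) / 2 - (a + c)) - (a * d - b * c))]

/-- Cap `Φ ≤ tw/2 + ℓ` for `t ≥ 0`, `ℓ ≥ 0` (the identity `2w(tw/2 + ℓ - Φ) = t(w - s)² + 2ℓs`). -/
theorem block_cap (a b c d : ℝ) (ha : 0 ≤ a) (hb : 0 ≤ b) (hc : 0 ≤ c) (hd : 0 ≤ d)
    (hτ : c + d ≤ a + b) (h1 : b * c ≤ a * d) :
    a * b - c * d ≤ (a + b - c - d) * ((a + b + c + d) / 2) / 2 + (a * d - b * c) := by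
  have key : 2 * ((a + b + c + d) / 2)
        * ((a + b - c - d) * ((a + b + c + d) / 2) / 2 + (a * d - b * c) - (a * b - c * d))
      = (a + b - c - d) * ((a + b + c + d) / 2 - (a + c)) ^ 2 + 2 * (a * d - b * c) * (a + c) := by
    ring
  have hw : 0 ≤ (a + b + c + d) / 2 := by linarith
  rcases eq_or_lt_of_le hw with hw0 | hwpos
  · have ha0 : a = 0 := by linarith
    have hb0 : b = 0 := by linarith
    have hc0 : c = 0 := by linarith
    have hd0 : d = 0 := by linarith
    subst ha0 hb0 hc0 hd0; norm_num
  · have h2 : 0 ≤ 2 * ((a + b + c + d) / 2)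
        * ((a + b - c - d) * ((a + b + c + d) / 2) / 2 + (a * d - b * c) - (a * b - c * d)) := by
      rw [key]
      exact add_nonneg (mul_nonneg (by linarith) (sq_nonneg _))
        (mul_nonneg (mul_nonneg (by norm_num) (by linarith)) (by linarith))
    have := (mul_nonneg_iff_of_pos_left (by linarith : (0:ℝ) < 2 * ((a + b + c + d) / 2))).1 h2
    linarith

/-- Beyond the junction (`twY ≤ ℓX`): `Y²Φ ≤ ℓ(XY - ℓ)` (the identity
`ℓ(XY - ℓ) - Y²Φ = q(2(ℓX - twY) + 2wtq)`, `q = c ≥ 0`). -/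
theorem block_beyond (a b c d : ℝ) (hc : 0 ≤ c) (hw : 0 ≤ a + b + c + d) (hτ : c + d ≤ a + b)
    (hr : (a + b - c - d) * ((a + b + c + d) / 2) * ((a + b + c + d) / 2 - (a + b - c - d) / 2)
      ≤ (a * d - b * c) * ((a + b + c + d) / 2 + (a + b - c - d) / 2)) :
    ((a + b + c + d) / 2 - (a + b - c - d) / 2) ^ 2 * (a * b - c * d)
      ≤ (a * d - b * c) * (((a + b + c + d) / 2 + (a + b - c - d) / 2)
          * ((a + b + c + d) / 2 - (a + b - c - d) / 2) - (a * d - b * c)) := by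
  nlinarith [mul_nonneg hc (sub_nonneg.2 hr),
    mul_nonneg (mul_nonneg hw (sub_nonneg.2 hτ)) (sq_nonneg c)]

/-- Orientation range `ℓ ≤ XY`. -/
theorem block_orient_le (a b c d : ℝ) (ha : 0 ≤ a) (hb : 0 ≤ b) (hc : 0 ≤ c) (hd : 0 ≤ d) :
    a * d - b * c ≤ ((a + b + c + d) / 2 + (a + b - c - d) / 2)
      * ((a + b + c + d) / 2 - (a + b - c - d) / 2) := by
  nlinarith [mul_nonneg ha hc, mul_nonneg hb hc, mul_nonneg hb hd]

/-- **The aligned half of the block inequality.**  If the target carries at least the model's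
diagonal mass (`c + d ≤ a + b`) and the orientations are `bc ≤ ad`, `eh ≤ fg`, then with
`L = (a + b - c - d) + (ad - bc) + (fg - eh) ≤ ½`:  `(ab - ef) - (cd - gh) ≤ L (1 - L)`. -/
theorem upper_half (a b c d e f g h : ℝ) (ha : 0 ≤ a) (hb : 0 ≤ b) (hc : 0 ≤ c) (hd : 0 ≤ d)
    (he : 0 ≤ e) (hf : 0 ≤ f) (hg : 0 ≤ g) (hh : 0 ≤ h)
    (hx : a + b + e + f = 1) (hy : c + d + g + h = 1)
    (hτ : c + d ≤ a + b) (h1 : b * c ≤ a * d) (h2 : e * h ≤ f * g)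
    (hL : (a + b - c - d) + (a * d - b * c) + (f * g - e * h) ≤ 1 / 2) :
    (a * b - e * f) - (c * d - g * h)
      ≤ ((a + b - c - d) + (a * d - b * c) + (f * g - e * h))
          * (1 - ((a + b - c - d) + (a * d - b * c) + (f * g - e * h))) := by
  -- block 2 has heavy pair `g, h` (model anti-diagonal) and light pair `e, f`, same transfer `t`
  have ht' : g + h - e - f = a + b - c - d := by linarith
  have s₂ := block_sup g h e f
  have c₂ := block_cap g h e f hg hh he hf (by linarith) (by linarith)
  have r₂ := block_beyond g h e f he (by linarith) (by linarith)
  have o₂ := block_orient_le g h e f hg hh he hf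
  rw [ht'] at s₂ c₂ r₂ o₂
  have M := mu_master (a + b - c - d) ((a + b + c + d) / 2) ((g + h + e + f) / 2)
    (a * d - b * c) (g * f - h * e) (a * b - c * d) (g * h - e * f)
    (by linarith) (by linarith) (by linarith) (by linarith) (by linarith) (by linarith)
    (block_orient_le a b c d ha hb hc hd) o₂ (by linarith)
    (block_sup a b c d) s₂ (block_cap a b c d ha hb hc hd hτ h1) c₂
    (block_beyond a b c d hc (by linarith) hτ) r₂
  linarith

/-! ## §3. The block inequality -/

/-- The block inequality when the target's diagonal is the heavier one (`c + d ≤ a + b`): the four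
orientation cases, each from `upper_half` and `lower_half` after relabelling within the blocks. -/
theorem blockIneq_of_le (a b c d e f g h : ℝ) (ha : 0 ≤ a) (hb : 0 ≤ b) (hc : 0 ≤ c) (hd : 0 ≤ d)
    (he : 0 ≤ e) (hf : 0 ≤ f) (hg : 0 ≤ g) (hh : 0 ≤ h)
    (hx : a + b + e + f = 1) (hy : c + d + g + h = 1) (hτ : c + d ≤ a + b)
    (hL : |a + b - c - d| + |a * d - b * c| + |e * h - f * g| ≤ 1 / 2) :
    |(a * b - e * f) - (c * d - g * h)|
      ≤ (|a + b - c - d| + |a * d - b * c| + |e * h - f * g|)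
          * (1 - (|a + b - c - d| + |a * d - b * c| + |e * h - f * g|)) := by
  rw [abs_of_nonneg (by linarith : (0:ℝ) ≤ a + b - c - d)] at hL ⊢
  rcases le_total (b * c) (a * d) with h1 | h1 <;> rcases le_total (e * h) (f * g) with h2 | h2
  · rw [abs_of_nonneg (by linarith : (0:ℝ) ≤ a * d - b * c),
      abs_of_nonpos (by linarith : e * h - f * g ≤ 0)] at hL ⊢
    have U := upper_half a b c d e f g h ha hb hc hd he hf hg hh hx hy hτ h1 h2 (by linarith)
    have D := lower_half a b c d f e h g ha hb hc hd hf he hh hg (by linarith) (by linarith) hτ h1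
      (by linarith) (by linarith)
    rw [abs_le]; constructor <;> linarith
  · rw [abs_of_nonneg (by linarith : (0:ℝ) ≤ a * d - b * c),
      abs_of_nonneg (by linarith : (0:ℝ) ≤ e * h - f * g)] at hL ⊢
    have U := upper_half a b c d f e h g ha hb hc hd hf he hh hg (by linarith) (by linarith) hτ h1
      (by linarith) (by linarith)
    have D := lower_half a b c d e f g h ha hb hc hd he hf hg hh hx hy hτ h1 h2 (by linarith)
    rw [abs_le]; constructor <;> linarith
  · rw [abs_of_nonpos (by linarith : a * d - b * c ≤ 0),
      abs_of_nonpos (by linarith : e * h - f * g ≤ 0)] at hL ⊢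
    have U := upper_half b a d c e f g h hb ha hd hc he hf hg hh (by linarith) (by linarith)
      (by linarith) (by linarith) h2 (by linarith)
    have D := lower_half b a d c f e h g hb ha hd hc hf he hh hg (by linarith) (by linarith)
      (by linarith) (by linarith) (by linarith) (by linarith)
    rw [abs_le]; constructor <;> linarith
  · rw [abs_of_nonpos (by linarith : a * d - b * c ≤ 0),
      abs_of_nonneg (by linarith : (0:ℝ) ≤ e * h - f * g)] at hL ⊢
    have U := upper_half b a d c f e h g hb ha hd hc hf he hh hg (by linarith) (by linarith)
      (by linarith) (by linarith) (by linarith) (by linarith)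
    have D := lower_half b a d c e f g h hb ha hd hc he hf hg hh (by linarith) (by linarith)
      (by linarith) (by linarith) h2 (by linarith)
    rw [abs_le]; constructor <;> linarith

/-- **The block inequality (BI)** — the section hypothesis `hB` of `AcceptanceCurveSwap`, now
PROVED: corner masses `≥ 0`, `a + b + e + f = c + d + g + h = 1`,
`L = |a + b - c - d| + |ad - bc| + |eh - fg| ≤ ½` ⟹ `|(ab - ef) - (cd - gh)| ≤ L (1 - L)`. -/
theorem blockIneq (a b c d e f g h : ℝ) (ha : 0 ≤ a) (hb : 0 ≤ b) (hc : 0 ≤ c) (hd : 0 ≤ d)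
    (he : 0 ≤ e) (hf : 0 ≤ f) (hg : 0 ≤ g) (hh : 0 ≤ h)
    (hx : a + b + e + f = 1) (hy : c + d + g + h = 1)
    (hL : |a + b - c - d| + |a * d - b * c| + |e * h - f * g| ≤ 1 / 2) :
    |(a * b - e * f) - (c * d - g * h)|
      ≤ (|a + b - c - d| + |a * d - b * c| + |e * h - f * g|)
          * (1 - (|a + b - c - d| + |a * d - b * c| + |e * h - f * g|)) := by
  rcases le_total (c + d) (a + b) with hτ | hτ
  · exact blockIneq_of_le a b c d e f g h ha hb hc hd he hf hg hh hx hy hτ hL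
  · -- exchange target and model: `(a, b, e, f) ↔ (c, d, g, h)`
    have e1 : |c + d - a - b| = |a + b - c - d| := by
      rw [show c + d - a - b = -(a + b - c - d) by ring, abs_neg]
    have e2 : |c * b - d * a| = |a * d - b * c| := by
      rw [show c * b - d * a = -(a * d - b * c) by ring, abs_neg]
    have e3 : |g * f - h * e| = |e * h - f * g| := by
      rw [show g * f - h * e = -(e * h - f * g) by ring, abs_neg]
    have e4 : |(c * d - g * h) - (a * b - e * f)| = |(a * b - e * f) - (c * d - g * h)| :=
      abs_sub_comm _ _
    have key := blockIneq_of_le c d a b g h e f hc hd ha hb hg hh he hf hy hx hτ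
      (by rw [e1, e2, e3]; exact hL)
    rw [e1, e2, e3, e4] at key
    exact key

/-! ## §4. The unconditional theorems

With `blockIneq` proved, the hypothesis `hB` of row 96a (`AcceptanceCurveSwap`, `section Block`) is
discharged; the unconditional statements are the TERMS

* `abs_det_sub_det_le_of_blockIneq blockIneq x y hx0 hy0 hxs hys hS :
    |det x - det y| ≤ S (1 - S)` (every pair of `2 × 2` probability tables with `S ≥ ½`);
* `curve_of_blockIneq blockIneq x y hx0 hy0 hxs hys ht ht2 : (2t - 1)² ≤ 1 - 4 |det x - det y|`
  (`½ ≤ t ≤ S`);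
* `sum_min_curve_full_of_blockIneq blockIneq x hx0 hs hp0 hp1 hq0 hq1 ht ht2 :
    (2t - 1)² ≤ 1 - 4 |x₊₊ x₋₋ - x₊₋ x₋₊|` — THEOREM Q♯♯ on the whole acceptance range, clause (ii)
  of `AcceptanceCurveFourPoint.sum_min_curve` with no regime hypothesis (product model with
  marginals `(p', 1 - p') ⊗ (q', 1 - q')`, any `t ∈ [½, 1]` not exceeding the sixteen-term mean swap
  acceptance; equivalently an exact swap acceptance `acc ≥ ½` against `x` forces
  `4|det x| ≤ 1 - (2acc - 1)² = 4 acc (1 - acc)`).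

They are not re-declared under new names (gate rule `dedup.landed`); row 96e uses the third term.
The three `example`s below kernel-check the terms at exactly theory-1's statements. -/

example (x y : Bool × Bool → ℝ)
    (hx0 : ∀ z, 0 ≤ x z) (hy0 : ∀ z, 0 ≤ y z)
    (hxs : x (true, true) + x (true, false) + x (false, true) + x (false, false) = 1)
    (hys : y (true, true) + y (true, false) + y (false, true) + y (false, false) = 1)
    (hS : 1 / 2 ≤ ∑ z : Bool × Bool, ∑ w : Bool × Bool, min (x z * y w) (x w * y z)) :
    |(x (true, true) * x (false, false) - x (true, false) * x (false, true))
        - (y (true, true) * y (false, false) - y (true, false) * y (false, true))|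
      ≤ (∑ z : Bool × Bool, ∑ w : Bool × Bool, min (x z * y w) (x w * y z))
          * (1 - ∑ z : Bool × Bool, ∑ w : Bool × Bool, min (x z * y w) (x w * y z)) :=
  abs_det_sub_det_le_of_blockIneq blockIneq x y hx0 hy0 hxs hys hS

example (x y : Bool × Bool → ℝ)
    (hx0 : ∀ z, 0 ≤ x z) (hy0 : ∀ z, 0 ≤ y z)
    (hxs : x (true, true) + x (true, false) + x (false, true) + x (false, false) = 1)
    (hys : y (true, true) + y (true, false) + y (false, true) + y (false, false) = 1) {t : ℝ}
    (ht : t ≤ ∑ z : Bool × Bool, ∑ w : Bool × Bool, min (x z * y w) (x w * y z)) (ht2 : 1 / 2 ≤ t) :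
    (2 * t - 1) ^ 2 ≤ 1 - 4 * |(x (true, true) * x (false, false) - x (true, false) * x (false, true))
        - (y (true, true) * y (false, false) - y (true, false) * y (false, true))| :=
  curve_of_blockIneq blockIneq x y hx0 hy0 hxs hys ht ht2

example (x : Bool × Bool → ℝ) {p' q' t : ℝ}
    (hx0 : ∀ z, 0 ≤ x z)
    (hs : x (true, true) + x (true, false) + x (false, true) + x (false, false) = 1) (hp0 : 0 ≤ p')
    (hp1 : p' ≤ 1) (hq0 : 0 ≤ q') (hq1 : q' ≤ 1)
    (ht : t ≤ ∑ z : Bool × Bool, ∑ w : Bool × Bool,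
        min (x z * ((if w.1 then p' else 1 - p') * (if w.2 then q' else 1 - q')))
          (x w * ((if z.1 then p' else 1 - p') * (if z.2 then q' else 1 - q'))))
    (ht2 : 1 / 2 ≤ t) :
    (2 * t - 1) ^ 2 ≤ 1 - 4 * |x (true, true) * x (false, false) - x (true, false) * x (false, true)| :=
  sum_min_curve_full_of_blockIneq blockIneq x hx0 hs hp0 hp1 hq0 hq1 ht ht2

end Summit.Ventures.LatticeQCDFlow.TrivializingMaps.Curve
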